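import Literature.AnabelianGeometry.EtaleTheta.GalSectCuspTorsorStructureGroupKummer
import Mathlib.FieldTheory.Galois.Infinite
import HarnessLib

/-!
# [GalSect] §4 at a NON-rational cusp: the structure group of the cusp torsor is `(k(x)^×)^∧`, `k(x) ⊇ K` the
# (finite) residue field cut out by the open image `aug(D_x) ≤ G_K` — the clause «`aug(D_x) = G_K`» of p468879 REMOVED

S. Mochizuki, *Galois sections in absolute anabelian geometry* [GalSect], Nagoya Math. J. **179** (2005), §4 p. 33 («`1 → I_x → D_x → G_K
→ 1`, `I_x ≅ Ẑ(1)` … torsor over `H¹(G_K, Ẑ(1)) ≅ (K^×)^∧`», for a point rational over the base field) [cite: MochizukiGalSect2005, §4 p.33];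
S. Mochizuki, *Semi-graphs of anabelioids* [SemiAnbd], Publ. RIMS **42** (2006), §6 p. 71 («`D_x` always surjects onto an open subgroup
of `G_K`») [cite: MochizukiSemiAnbd2006, §6 p.71]; infinite Galois theory (Krull: open subgroups ↔ finite subextensions)
[cite: NeukirchANT1999, Ch. IV §1 Thm (1.2) p.262].

abc-iut cell, layer L2, seat abc-iut-w5-d029 (gen 7); sequel (S1b) of the (B4) assembly of record p468879
(`GalSect.CuspPair.nonempty_completion_mulEquiv_resKer_of_isCyclotomic`).  PROOF-ONLY (no definition, no `Prop` fact, no instance).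
p468879 carries the clause «`aug(D_x) = G_K`» (the cusp is `K`-rational — true for [EtTh]'s unique cusp, p458429).  For an ARBITRARY
cusp of `X : TemperedCurve p` the frozen interface clause `isOpen_aug_decomp` («`D_x` surjects onto an OPEN subgroup of `G_K`») suffices:

* `GalSect.exists_fixingSubgroup_continuousMulEquiv_absoluteGaloisGroup` — the junction `k.fixingSubgroup ≃ₜ* Gal(k^al/k)` compatibly
  with a `k`-isomorphism `ι : k^al ≃ ℚ̄_p`, for EVERY intermediate field `k` of `ℚ̄_p/ℚ_p` (abc-iut-w6-d047's
  `exists_GK_continuousMulEquiv_absoluteGaloisGroup` is the case `k = K(X)`; same proof);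
* `GalSect.exists_intermediateField_fixingSubgroup_eq_of_isOpen` — an OPEN subgroup `H ≤ G_{ℚ_p}` is the fixing subgroup of a FINITE
  extension `k/ℚ_p` inside `ℚ̄_p` (Krull topology: `InfiniteGalois.fixingSubgroup_fixedField` + `isOpen_iff_finite`), with `K ≤ k` when
  `H ≤ G_K`;
* **`GalSect.exists_residueField_completion_mulEquiv_resKer_of_isCyclotomicCusp`** — for every cusp `x` of `X : TemperedCurve p`
  with «`I_x ≅ Ẑ(1)`» (`IsCyclotomicCusp`) and `D_x` compact, and every base splitting: there is a finite `k(x) ⊇ K(X)` inside `ℚ̄_p`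
  with `Gal(ℚ̄_p/k(x)) = aug(D_x)` and **`Nonempty ((k(x)^×)^∧ ≃* Ker(res : H¹(D_x, I_x) → H¹(I_x, I_x)))`** — the structure group
  of the torsor `cuspTorsorH1` is the completed multiplicative group of the residue field of the cusp.

HONEST FRAMING: classical Galois bookkeeping over the tree's constructions; [GalSect]/[SemiAnbd] are refereed; `IsCompact D_x` is not an
interface clause (a theorem at `CuspLaws` data, p470508); no side taken on [IUTchIII] Cor. 3.12; typed ≠ proved.
-/

noncomputable section

namespace Literature.AnabelianGeometry.EtaleTheta

open Literature.AnabelianGeometry.SemiGraphs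
open Literature.AnabelianGeometry.AbsoluteAnabelian
open Literature.NumberTheory.GaloisRepresentations
open CategoryTheory ProfiniteGrp ProfiniteGrp.ProfiniteCompletion
open _root_.Topology _root_.Function

namespace GalSect

variable {p : ℕ} [Fact p.Prime]

/-- **`Gal(ℚ̄_p/k) ≃ₜ* Gal(k^al/k)` compatibly with a `k`-isomorphism `k^al ≅ ℚ̄_p`**, for EVERY intermediate field `k` of
`ℚ̄_p / ℚ_p`: there are `ι : k^al ≃ₐ[k] ℚ̄_p` and `Φ : k.fixingSubgroup ≃ₜ* Gal(k^al/k)` (Mathlib's `Field.absoluteGaloisGroup k`) with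
`ι (Φ(σ) x) = σ (ι x)` (infinite Galois theory: the closed subgroup `G(Ω|k)` of `G(Ω|ℚ_p)` IS the Galois group of `Ω|k`, Krull
topologies included; abc-iut-w6-d047's junction, generalised from `K(X)` to any `k`). [cite: NeukirchANT1999, Ch. IV §1 Thm (1.2) p.262] -/
theorem exists_fixingSubgroup_continuousMulEquiv_absoluteGaloisGroup (k : IntermediateField ℚ_[p] (PadicAlgCl p)) :
    ∃ (ι : AlgebraicClosure k ≃ₐ[k] PadicAlgCl p) (Φ : k.fixingSubgroup ≃ₜ* Field.absoluteGaloisGroup k),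
      ∀ (σ : k.fixingSubgroup) (x : AlgebraicClosure k), ι (Φ σ • x) = (σ : GQp p) • ι x := by
  haveI := PadicAlgCl.isAlgClosure_subfield k
  obtain ⟨e₁, he₁⟩ := exists_fixingSubgroup_continuousMulEquiv (F := ℚ_[p]) (E := PadicAlgCl p) k
  let ι₀ : PadicAlgCl p ≃ₐ[k] AlgebraicClosure k := IsAlgClosure.equiv k (PadicAlgCl p) (AlgebraicClosure k)
  refine ⟨ι₀.symm, e₁.trans (algEquivContinuousMulEquivAbsoluteGaloisGroup k (PadicAlgCl p)), ?_⟩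
  intro σ x
  have h1 : (e₁ σ : PadicAlgCl p ≃ₐ[k] PadicAlgCl p) = IntermediateField.fixingSubgroupEquiv k σ := by
    rw [← he₁]; rfl
  change ι₀.symm (ι₀ ((e₁ σ) (ι₀.symm x))) = (σ : GQp p) (ι₀.symm x)
  rw [ι₀.symm_apply_apply, h1]
  rfl

/-- **An OPEN subgroup of `G_{ℚ_p}` is the absolute Galois group of a FINITE extension `k/ℚ_p` inside `ℚ̄_p`** (`k` = its fixed field;
Krull topology), and `K ≤ k` whenever the subgroup lies in `G_K`. [cite: NeukirchANT1999, Ch. IV §1 Thm (1.2) p.262] -/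
theorem exists_intermediateField_fixingSubgroup_eq_of_isOpen (H : Subgroup (GQp p)) (hH : IsOpen (H : Set (GQp p)))
    (K : IntermediateField ℚ_[p] (PadicAlgCl p)) (hHK : H ≤ K.fixingSubgroup) :
    ∃ k : IntermediateField ℚ_[p] (PadicAlgCl p), FiniteDimensional ℚ_[p] k ∧ K ≤ k ∧ k.fixingSubgroup = H := by
  haveI : IsGalois ℚ_[p] (PadicAlgCl p) := {}
  have hk : (IntermediateField.fixedField H).fixingSubgroup = H :=
    InfiniteGalois.fixingSubgroup_fixedField ⟨H, H.isClosed_of_isOpen hH⟩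
  refine ⟨IntermediateField.fixedField H, ?_, (IntermediateField.le_iff_le H K).mpr hHK, hk⟩
  refine (InfiniteGalois.isOpen_iff_finite _).mp ?_
  change IsOpen ((IntermediateField.fixedField H).fixingSubgroup : Set (GQp p))
  rw [hk]
  exact hH

/-- **[GalSect] §4 at an ARBITRARY cusp: the structure group of the cusp torsor is `(k(x)^×)^∧`.**  For a cusp `x` of
`X : TemperedCurve p` with «`I_x ≅ Ẑ(1)`» (`IsCyclotomicCusp X x`) and `D_x` compact, and any base splitting `S₀`: the open image
`aug(D_x) ≤ G_K` (interface clause `isOpen_aug_decomp`, [SemiAnbd] §6 p. 71) is `Gal(ℚ̄_p/k(x))` for a finite extension `k(x) ⊇ K(X)`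
inside `ℚ̄_p`, and `Ker(res : H¹(D_x, I_x) → H¹(I_x, I_x)) ≅ (k(x)^×)^∧` — p468879 with `K := k(x)`, `L := aug(D_x)`.
[cite: MochizukiGalSect2005, §4 p.33] -/
theorem exists_residueField_completion_mulEquiv_resKer_of_isCyclotomicCusp (X : TemperedCurve p) [T1Space X.PiTemp]
    {x : X.Pt} (hx : X.IsCusp x) (hcyc : IsCyclotomicCusp X x) (hDc : IsCompact (X.decomp x : Set X.PiTemp))
    {S₀ : Subgroup X.PiTemp} (hS₀ : S₀ ∈ (cuspPairOf X x).splittings) :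
    haveI : IsMulCommutative (cuspPairOf X x).I := X.isMulCommutative_inertia hx
    haveI := (cuspPairOf X x).ID_normal
    ∃ k : IntermediateField ℚ_[p] (PadicAlgCl p), FiniteDimensional ℚ_[p] k ∧ X.K ≤ k ∧
      k.fixingSubgroup = (X.decomp x).map X.aug.toMonoidHom ∧
      Nonempty (completion (GrpCat.of (↥k)ˣ) ≃* ContH1.resKer (cuspPairOf X x).ID (⊤ : Subgroup (cuspPairOf X x).D)
        ((cuspPairOf X x).isClosedComplement_of_mem_splittings hS₀).le_left) := by
  haveI : IsMulCommutative (cuspPairOf X x).I := X.isMulCommutative_inertia hx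
  have hopen : IsOpen (((X.decomp x).map X.aug.toMonoidHom : Subgroup (GQp p)) : Set (GQp p)) := by
    rw [Subgroup.coe_map]
    exact X.isOpen_aug_decomp x
  have hle : (X.decomp x).map X.aug.toMonoidHom ≤ X.K.fixingSubgroup := by
    rw [← X.range_aug]
    exact Subgroup.map_le_range _ _
  obtain ⟨k, hfd, hKk, hk⟩ := exists_intermediateField_fixingSubgroup_eq_of_isOpen _ hopen X.K hle
  haveI := hfd
  haveI : CharZero ↥k := charZero_of_injective_algebraMap (algebraMap ℚ_[p] ↥k).injective
  obtain ⟨ι, Φ, hΦ⟩ := exists_fixingSubgroup_continuousMulEquiv_absoluteGaloisGroup k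
  exact ⟨k, hfd, hKk, hk, (cuspPairOf X x).nonempty_completion_mulEquiv_resKer_of_isCyclotomic X.aug ↥k
    (fun n => finiteIndex_range_powMonoidHom_units_padic (p := p) ↥k n n.ne_zero) k.fixingSubgroup Φ ι.toRingEquiv
    (fun σ y => hΦ σ y) hcyc hDc (fun d hd => ⟨fun h => h.2, fun h => ⟨hd, h⟩⟩) hk.symm hS₀⟩

end GalSect

end Literature.AnabelianGeometry.EtaleTheta

end
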